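import Summits.QuantumAdvantage.QuantumAdvantage.Theorems.WalkFiniteState
import Mathlib.Data.Fintype.Fin

/-!
# `NoPerfectFinState2 5 38` — no finite-state 2-step strategy is perfect for `n ≥ 38` (planner qa-qnc0-p2 g21, ROUND-21 §6 (H),
# the PENCIL TAIL; ask P2-21 (e); `--supports` crux `ManyReadersSqrtOdd` stmt-QuantumAdvantage-23109)

Prover seat qn-prover-3 g14.  For `p = 5` and every ring length `n ≥ 38`, charge `c` and strategy `y` in the class `FinState2 5`
(every cut's test is a table `T g (wtPrefix u g mod 5) (wt u mod 5)`), some input loses the u-walk game: `∃ u, ringWinU c y u = false`.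
The planner's exact computation puts the SHARP threshold at `n₀ = 12` (perfect strategies exist at `n = 10, 11`); this file proves the
computation-free tail `n ≥ 38` of ROUND-21 §6 (H) verbatim:

1. TRANSPOSITION STEP (`fs2_step`): swapping two adjacent unequal bits `(u_j, u_{j+1}) = (1, 0) ↦ (0, 1)` keeps `wt` and every prefix
   count except `wtPrefix · (j+1)`, which drops by one; all other cuts see the same table entry and the same walk label, so for a
   PERFECT strategy the parity of the fired-live set forces cut `j+1`'s fired-live bit to agree on the two inputs
   (`mem_iff_of_card_mod_two`).
2. MIDDLE CUTS ARE OFF (`middle_off`): for `14 ≤ g ≤ n − 14`, weight `15` and prefix counts `x, x+1` in a window of `15` consecutive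
   values realised by two-block inputs (`twoBlocks`), step 1 makes `x ↦ T g x 0 ∧ live(c+g+15+x)` constant on the window; it vanishes
   where the label is `0 (mod 3)`, hence everywhere, and every residue `r (mod 5)` occurs in the window at a live label, so `T g r 0 = false`.
3. THREE INPUTS (`noPerfectFinState2_38`): `u_k =` ones on `[14, 14+5k)`, `k = 0, 1, 2` (weights `0, 5, 10 ≡ 0 (mod 5)`): start cuts
   `g < 14` read `T g 0 0` with label `c + g + 5k ≡ c + g + 2k`, end cuts `g > n − 14` read `T g 0 0` with label `c + g + 10k ≡ c + g + k`,
   middle cuts are off; so the three fired-live sets are `{g ∈ F : s_g + k·t_g ≠ 0}` with `t_g ∈ {2, 1}`, and the planner's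
   `twistedNotAllThree` says they cannot all be odd.

WHAT THIS IS NOT: the sharp threshold `12 ≤ n ≤ 37` (a finite computation, not done here); nothing about polynomial strategies or the
rung `TwoStepFiniteStateWalkHard`; separation NOT moved.
-/

open Finset

namespace Summit.QuantumAdvantage.AdviceFreeQNC0

namespace Coset21

variable {n : ℕ}

/-! ### Counting bits of interval indicators -/

/-- Counting positions of `Fin n` by a predicate on the value. -/
theorem card_filter_val (P : ℕ → Prop) [DecidablePred P] :
    (univ.filter fun i : Fin n => P i.val).card = ((Iio n).filter P).card := by
  rw [← Fin.map_valEmbedding_univ, Finset.filter_map, Finset.card_map]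
  rfl

/-- The positions `i < n` with `a ≤ i < b` (`b ≤ n`) number `b − a`. -/
theorem card_Iio_filter_Ico {a b : ℕ} (hb : b ≤ n) :
    ((Iio n).filter fun i => a ≤ i ∧ i < b).card = b - a := by
  have : ((Iio n).filter fun i => a ≤ i ∧ i < b) = Ico a b := by
    ext i
    simp only [mem_filter, mem_Iio, mem_Ico]
    omega
  rw [this, Nat.card_Ico]

/-- The input with ones exactly on `[a, b) ∪ [a', b')`. -/
def twoBlocks (n a b a' b' : ℕ) : Fin n → Bool :=
  fun i => decide ((a ≤ i.val ∧ i.val < b) ∨ (a' ≤ i.val ∧ i.val < b'))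

/-- Weight of a two-block input with `b ≤ a' ≤ b' ≤ n`. -/
theorem wt_twoBlocks {a b a' b' : ℕ} (h2 : b ≤ a') (h3 : a' ≤ b') (h4 : b' ≤ n) :
    wt (twoBlocks n a b a' b') = (b - a) + (b' - a') := by
  unfold wt twoBlocks
  have e : (univ.filter fun i : Fin n => decide ((a ≤ i.val ∧ i.val < b) ∨ (a' ≤ i.val ∧ i.val < b')) = true) =
      univ.filter fun i : Fin n => (a ≤ i.val ∧ i.val < b) ∨ (a' ≤ i.val ∧ i.val < b') := by
    ext i; simp only [mem_filter, mem_univ, true_and, decide_eq_true_eq]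
  rw [e, card_filter_val (fun i => (a ≤ i ∧ i < b) ∨ (a' ≤ i ∧ i < b')), filter_or,
    card_union_of_disjoint, card_Iio_filter_Ico (by omega), card_Iio_filter_Ico h4]
  rw [disjoint_left]
  intro i hi hi'
  rw [mem_filter] at hi hi'
  omega

/-- Prefix weight of a two-block input at a cut `g` inside (or at the ends of) the first block: `g − a` (`g ≤ b ≤ a'`). -/
theorem wtPrefix_twoBlocks_first {a b a' b' g : ℕ} (h2 : g ≤ b) (h3 : b ≤ a') (h4 : g ≤ n) :
    wtPrefix (twoBlocks n a b a' b') g = g - a := by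
  unfold wtPrefix twoBlocks
  have e : (univ.filter fun i : Fin n =>
        i.val < g ∧ decide ((a ≤ i.val ∧ i.val < b) ∨ (a' ≤ i.val ∧ i.val < b')) = true) =
      univ.filter fun i : Fin n => a ≤ i.val ∧ i.val < g := by
    ext i
    simp only [mem_filter, mem_univ, true_and, decide_eq_true_eq]
    omega
  rw [e, card_filter_val (fun i => a ≤ i ∧ i < g), card_Iio_filter_Ico h4]

/-- Prefix weight of a two-block input at a cut `g` before both blocks. -/
theorem wtPrefix_twoBlocks_left {a b a' b' g : ℕ} (h1 : g ≤ a) (h2 : a ≤ a') :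
    wtPrefix (twoBlocks n a b a' b') g = 0 := by
  unfold wtPrefix twoBlocks
  rw [card_eq_zero, filter_eq_empty_iff]
  intro i _ h
  rw [decide_eq_true_eq] at h
  omega

/-- Prefix weight of a two-block input at a cut `g` after both blocks is the weight. -/
theorem wtPrefix_twoBlocks_right {a b a' b' g : ℕ} (h1 : b ≤ g) (h2 : b' ≤ g) :
    wtPrefix (twoBlocks n a b a' b') g = wt (twoBlocks n a b a' b') := by
  unfold wtPrefix wt twoBlocks
  congr 1
  ext i
  simp only [mem_filter, mem_univ, true_and, decide_eq_true_eq]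
  constructor
  · exact fun h => h.2
  · intro h; exact ⟨by omega, h⟩

/-! ### Adjacent transpositions -/

/-- The weight is invariant under a permutation of the positions. -/
theorem wt_comp_perm (u : Fin n → Bool) (σ : Equiv.Perm (Fin n)) : wt (u ∘ σ) = wt u := by
  unfold wt
  refine card_bij (fun i _ => σ i) (fun i hi => ?_) (fun i _ i' _ h => σ.injective h) (fun k hk => ?_)
  · rw [mem_filter] at hi ⊢; exact ⟨mem_univ _, hi.2⟩
  · refine ⟨σ.symm k, ?_, σ.apply_symm_apply k⟩
    rw [mem_filter] at hk ⊢
    exact ⟨mem_univ _, by rw [Function.comp_apply, σ.apply_symm_apply]; exact hk.2⟩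

/-- An adjacent transposition `(j, j+1)` changes no prefix count except the one at `j+1`. -/
theorem wtPrefix_comp_swap_of_ne (u : Fin n → Bool) (j j₁ : Fin n) (hj : j₁.val = j.val + 1) {h : ℕ}
    (hh : h ≠ j.val + 1) : wtPrefix (u ∘ Equiv.swap j j₁) h = wtPrefix u h := by
  unfold wtPrefix
  have hval : ∀ i : Fin n, (Equiv.swap j j₁ i).val < h ↔ i.val < h := by
    intro i
    by_cases hij : i = j
    · subst hij; rw [Equiv.swap_apply_left]; omega
    · by_cases hij₁ : i = j₁
      · subst hij₁; rw [Equiv.swap_apply_right]; omega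
      · rw [Equiv.swap_apply_of_ne_of_ne hij hij₁]
  refine card_bij (fun i _ => Equiv.swap j j₁ i) (fun i hi => ?_) (fun i _ i' _ h => (Equiv.swap j j₁).injective h)
    (fun k hk => ?_)
  · rw [mem_filter] at hi ⊢
    exact ⟨mem_univ _, (hval i).2 hi.2.1, hi.2.2⟩
  · refine ⟨Equiv.swap j j₁ k, ?_, Equiv.swap_apply_self _ _ _⟩
    rw [mem_filter] at hk ⊢
    refine ⟨mem_univ _, ?_, ?_⟩
    · have := (hval (Equiv.swap j j₁ k)); rw [Equiv.swap_apply_self] at this; exact this.1 hk.2.1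
    · rw [Function.comp_apply, Equiv.swap_apply_self]; exact hk.2.2

/-- At the cut `j+1`: if `u_j = 1`, `u_{j+1} = 0` then the swapped input has one fewer one before the cut. -/
theorem wtPrefix_swap_succ (u : Fin n → Bool) (j j₁ : Fin n) (hj : j₁.val = j.val + 1) (h1 : u j = true)
    (h2 : u j₁ = false) :
    wtPrefix u (j.val + 1) = wtPrefix u j.val + 1 ∧
      wtPrefix (u ∘ Equiv.swap j j₁) (j.val + 1) = wtPrefix u j.val := by
  have hjn : j.val < n := j.isLt
  constructor
  · rw [wtPrefix_succ u j.val hjn]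
    have : (⟨j.val, hjn⟩ : Fin n) = j := Fin.ext rfl
    rw [this, if_pos h1]
  · rw [wtPrefix_succ _ j.val hjn, wtPrefix_comp_swap_of_ne u j j₁ hj (by omega)]
    have : (⟨j.val, hjn⟩ : Fin n) = j := Fin.ext rfl
    rw [this, Function.comp_apply, Equiv.swap_apply_left, h2]
    simp

/-- Parity bookkeeping: two finite sets that agree off one point and have cardinalities of the same parity agree at the point. -/
theorem mem_iff_of_card_mod_two {α : Type*} [DecidableEq α] (A B : Finset α) (a : α)
    (h : ∀ x, x ≠ a → (x ∈ A ↔ x ∈ B)) (hA : A.card % 2 = 1) (hB : B.card % 2 = 1) : (a ∈ A ↔ a ∈ B) := by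
  have hE : A.erase a = B.erase a := by
    ext x
    by_cases hx : x = a
    · subst hx; simp
    · rw [mem_erase, mem_erase, h x hx]
  by_cases ha : a ∈ A <;> by_cases hb : a ∈ B
  · exact ⟨fun _ => hb, fun _ => ha⟩
  · exfalso
    have h1 := card_erase_add_one ha
    rw [hE, erase_eq_of_notMem hb] at h1
    omega
  · exfalso
    have h1 := card_erase_add_one hb
    rw [← hE, erase_eq_of_notMem ha] at h1
    omega
  · exact ⟨fun h => absurd h ha, fun h => absurd h hb⟩

/-- **Transposition step.**  For a PERFECT `FinState2 5` strategy and an input with `(u_j, u_{j+1}) = (1, 0)`: with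
`X = wtPrefix u j`, `W = wt u`, cut `j+1` has the same fired-live bit at prefix counts `X + 1` (input `u`) and `X` (swapped input). -/
theorem fs2_step (T : Fin (n + 1) → ZMod 5 → ZMod 5 → Bool) (c : ℕ) (y : Fin (n + 1) → (Fin n → Bool) → Bool)
    (hT : ∀ g u, y g u = T g ((wtPrefix u g.val : ℕ) : ZMod 5) ((wt u : ℕ) : ZMod 5))
    (hperf : ∀ u, ringWinU c y u = true) (u : Fin n → Bool) (j j₁ : Fin n) (hj : j₁.val = j.val + 1)
    (h1 : u j = true) (h2 : u j₁ = false) :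
    (T ⟨j.val + 1, by omega⟩ ((wtPrefix u j.val + 1 : ℕ) : ZMod 5) ((wt u : ℕ) : ZMod 5) = true ∧
        (c + (j.val + 1) + (wt u + (wtPrefix u j.val + 1))) % 3 ≠ 0) ↔
      (T ⟨j.val + 1, by omega⟩ ((wtPrefix u j.val : ℕ) : ZMod 5) ((wt u : ℕ) : ZMod 5) = true ∧
        (c + (j.val + 1) + (wt u + wtPrefix u j.val)) % 3 ≠ 0) := by
  set u' : Fin n → Bool := u ∘ Equiv.swap j j₁ with hu'
  obtain ⟨hX, hX'⟩ := wtPrefix_swap_succ u j j₁ hj h1 h2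
  rw [← hu'] at hX'
  have hW : wt u' = wt u := wt_comp_perm u _
  set g₀ : Fin (n + 1) := ⟨j.val + 1, by omega⟩ with hg₀
  set A := univ.filter fun g : Fin (n + 1) => y g u = true ∧ (c + g.val + walkExp u g.val) % 3 ≠ 0 with hA
  set B := univ.filter fun g : Fin (n + 1) => y g u' = true ∧ (c + g.val + walkExp u' g.val) % 3 ≠ 0 with hB
  have hAcard : A.card % 2 = 1 := by
    have h := hperf u; unfold ringWinU at h; rw [decide_eq_true_eq] at h; exact h
  have hBcard : B.card % 2 = 1 := by
    have h := hperf u'; unfold ringWinU at h; rw [decide_eq_true_eq] at h; exact h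
  have hoff : ∀ g : Fin (n + 1), g ≠ g₀ → (g ∈ A ↔ g ∈ B) := by
    intro g hg
    have hgv : g.val ≠ j.val + 1 := fun h => hg (Fin.ext h)
    rw [hA, hB, mem_filter, mem_filter, hT g u, hT g u']
    unfold walkExp
    rw [hW, hu', wtPrefix_comp_swap_of_ne u j j₁ hj hgv]
  have key := mem_iff_of_card_mod_two A B g₀ hoff hAcard hBcard
  rw [hA, hB, mem_filter, mem_filter, hT g₀ u, hT g₀ u'] at key
  unfold walkExp at key
  simp only [mem_univ, true_and, hg₀, Fin.val_mk] at key
  rw [hX, hX', hW] at key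
  exact key

/-! ### Middle cuts are off -/

/-- `x % 3 ≠ 0` shifted by `5`: among `a` and `a + 5` at least one label is live. -/
theorem live_or_live_add_five (L a : ℕ) : (L + a) % 3 ≠ 0 ∨ (L + (a + 5)) % 3 ≠ 0 := by
  omega

/-- **Middle cuts are OFF** for a perfect `FinState2 5` strategy, `n ≥ 38`: `T g r 0 = false` for `14 ≤ g ≤ n − 14` and every `r`.
(Weight-`15` two-block inputs around the cut realise `15` consecutive prefix counts; constancy by `fs2_step`; a dead label kills the
constant; every residue mod `5` meets a live label.) -/
theorem middle_off (T : Fin (n + 1) → ZMod 5 → ZMod 5 → Bool) (c : ℕ) (y : Fin (n + 1) → (Fin n → Bool) → Bool)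
    (hT : ∀ g u, y g u = T g ((wtPrefix u g.val : ℕ) : ZMod 5) ((wt u : ℕ) : ZMod 5))
    (hperf : ∀ u, ringWinU c y u = true) (hn : 38 ≤ n) (g : ℕ) (hg1 : 14 ≤ g) (hg2 : g + 14 ≤ n) (r : ZMod 5) :
    T ⟨g, by omega⟩ r 0 = false := by
  -- the window of prefix counts `[lo, lo + 14]`
  set lo : ℕ := if g + 14 = n then 1 else 0 with hlo
  have hlo1 : lo ≤ 1 := by rw [hlo]; split_ifs <;> omega
  have hlog : lo + 14 ≤ g := by
    rw [hlo]; split_ifs <;> omega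
  have hlon : g + 15 ≤ n + lo := by
    rw [hlo]; split_ifs <;> omega
  -- the fired-live bit of cut `g` at weight 15 and prefix count `x`
  set f : ℕ → Prop := fun x => T ⟨g, by omega⟩ ((x : ℕ) : ZMod 5) ((15 : ℕ) : ZMod 5) = true ∧
    (c + g + (15 + x)) % 3 ≠ 0 with hf
  -- one step of constancy, from the two-block input with `x + 1` ones just before the cut
  have hstep : ∀ x, lo ≤ x → x ≤ lo + 13 → (f (x + 1) ↔ f x) := by
    intro x hx1 hx2
    have hxg : x + 1 ≤ g := by omega
    have hxn : g + 15 ≤ n + x := by omega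
    set v := twoBlocks n (g - 1 - x) g (g + 1) (g + 15 - x) with hv
    have hwt : wt v = 15 := by
      rw [hv, wt_twoBlocks (by omega) (by omega) (by omega)]; omega
    have hpre : wtPrefix v (g - 1) = x := by
      rw [hv, wtPrefix_twoBlocks_first (by omega) (by omega) (by omega)]; omega
    have hj : (⟨g, by omega⟩ : Fin n).val = (⟨g - 1, by omega⟩ : Fin n).val + 1 := by
      simp only; omega
    have h1 : v ⟨g - 1, by omega⟩ = true := by
      rw [hv]; unfold twoBlocks; rw [decide_eq_true_eq]; simp only; omega
    have h2 : v ⟨g, by omega⟩ = false := by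
      rw [hv]; unfold twoBlocks; rw [decide_eq_false_iff_not]; simp only; omega
    have key := fs2_step T c y hT hperf v ⟨g - 1, by omega⟩ ⟨g, by omega⟩ hj h1 h2
    simp only at key
    rw [hpre, hwt] at key
    have hg1' : g - 1 + 1 = g := by omega
    simp only [hg1'] at key
    rw [hf]
    exact key
  -- constancy on the window
  have hconst : ∀ d, d ≤ 14 → (f (lo + d) ↔ f lo) := by
    intro d hd
    induction d with
    | zero => simp
    | succ d ih =>
      rw [← ih (by omega), show lo + (d + 1) = (lo + d) + 1 by omega]
      exact hstep (lo + d) (by omega) (by omega)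
  -- a dead label in the window kills the constant
  have hdead : ∀ d, d ≤ 14 → ¬ f (lo + d) := by
    intro d hd hfd
    set d₀ := (3 - (c + g + 15 + lo) % 3) % 3 with hd₀
    have hd₀3 : d₀ ≤ 2 := by omega
    have h0 : (c + g + (15 + (lo + d₀))) % 3 = 0 := by omega
    have := ((hconst d₀ (by omega)).2 ((hconst d hd).1 hfd)).2
    exact this h0
  -- every residue class mod 5 meets the window at a live label
  set a : ℕ := lo + (r.val + 5 - lo) % 5 with ha
  have har : a % 5 = r.val := by
    have := r.val_lt; omega
  have ha14 : a ≤ lo + 4 := by omega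
  rcases live_or_live_add_five (c + g + 15) a with hlive | hlive
  · have hnf := hdead (a - lo) (by omega)
    rw [show lo + (a - lo) = a by omega, hf] at hnf
    simp only [not_and, not_not] at hnf
    have hcast : ((a : ℕ) : ZMod 5) = r := by
      rw [← ZMod.natCast_zmod_val r, ZMod.natCast_eq_natCast_iff', har, Nat.mod_eq_of_lt r.val_lt]
    have h15 : ((15 : ℕ) : ZMod 5) = 0 := by decide
    rw [hcast, h15] at hnf
    by_contra hT0
    have hT1 : T ⟨g, by omega⟩ r 0 = true := by
      cases h : T ⟨g, by omega⟩ r 0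
      · exact absurd h hT0
      · rfl
    exact absurd (hnf hT1) (by omega)
  · have hnf := hdead (a + 5 - lo) (by omega)
    rw [show lo + (a + 5 - lo) = a + 5 by omega, hf] at hnf
    simp only [not_and, not_not] at hnf
    have hcast : ((a + 5 : ℕ) : ZMod 5) = r := by
      rw [← ZMod.natCast_zmod_val r, ZMod.natCast_eq_natCast_iff', Nat.mod_eq_of_lt r.val_lt]
      omega
    have h15 : ((15 : ℕ) : ZMod 5) = 0 := by decide
    rw [hcast, h15] at hnf
    by_contra hT0
    have hT1 : T ⟨g, by omega⟩ r 0 = true := by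
      cases h : T ⟨g, by omega⟩ r 0
      · exact absurd h hT0
      · rfl
    exact absurd (hnf hT1) (by omega)

/-! ### The theorem -/

/-- `(x : ZMod 3) ≠ 0 ↔ x % 3 ≠ 0`. -/
theorem natCast_zmod3_ne_zero_iff (x : ℕ) : (x : ZMod 3) ≠ 0 ↔ x % 3 ≠ 0 :=
  not_congr (natCast_zmod3_eq_zero_iff x)

/-- **`NoPerfectFinState2 5 38`** (ROUND-21 §6 (H), the pencil tail): for `n ≥ 38` no 2-step finite-state strategy modulo `5` wins the
u-walk game on every input, at any charge. -/
theorem noPerfectFinState2_38 : NoPerfectFinState2 5 38 := by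
  classical
  intro n hn c y hy
  obtain ⟨T, hT⟩ := hy
  by_contra hno
  push Not at hno
  have hperf : ∀ u, ringWinU c y u = true := by
    intro u
    cases h : ringWinU c y u
    · exact absurd h (hno u)
    · rfl
  -- the candidate fired set over the start and end cuts, labels and twists
  set F := (univ : Finset (Fin (n + 1))).filter fun g => (g.val < 14 ∨ n - 14 < g.val) ∧ T g 0 0 = true with hF
  set s : Fin (n + 1) → ZMod 3 := fun g => ((c + g.val : ℕ) : ZMod 3) with hs
  set t : Fin (n + 1) → ZMod 3 := fun g => if g.val < 14 then 2 else 1 with ht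
  have htne : ∀ g ∈ F, t g ≠ 0 := by
    intro g _
    rw [ht]; simp only
    split_ifs <;> decide
  refine twistedNotAllThree F s t htne fun k => ?_
  -- the input `u_k`: ones on `[14, 14 + 5k)`
  set m := k.val with hm
  have hm3 : m < 3 := k.val_lt
  set u := twoBlocks n 14 (14 + 5 * m) (14 + 5 * m) (14 + 5 * m) with hu
  have hwt : wt u = 5 * m := by
    rw [hu, wt_twoBlocks le_rfl le_rfl (by omega)]; omega
  have hw0 : ((wt u : ℕ) : ZMod 5) = 0 := by
    rw [hwt, Nat.cast_mul]
    have : ((5 : ℕ) : ZMod 5) = 0 := by decide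
    rw [this, zero_mul]
  have hkm : ((m : ℕ) : ZMod 3) = k := by rw [hm, ZMod.natCast_zmod_val]
  have h5 : (5 : ZMod 3) = 2 := by decide
  -- the fired-live set of `u_k` is the twisted filter of `F`
  have hA : (univ.filter fun g : Fin (n + 1) => y g u = true ∧ (c + g.val + walkExp u g.val) % 3 ≠ 0) =
      F.filter fun g => s g + k * t g ≠ 0 := by
    ext g
    rw [mem_filter, hF, mem_filter, mem_filter, hT g u, hw0]
    simp only [mem_univ, true_and]
    unfold walkExp
    rw [hwt]
    by_cases hg1 : g.val < 14
    · -- start cut: prefix count 0, label c + g + 5m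
      have hpre : wtPrefix u g.val = 0 := by rw [hu, wtPrefix_twoBlocks_left (by omega) (by omega)]
      rw [hpre, Nat.cast_zero, ← natCast_zmod3_ne_zero_iff]
      have hlab : ((c + g.val + (5 * m + 0) : ℕ) : ZMod 3) = s g + k * t g := by
        rw [hs, ht]
        simp only [hg1, if_true]
        push_cast
        rw [hkm, h5]
        ring
      rw [hlab]
      simp only [hg1, true_or, true_and]
    · by_cases hg2 : n - 14 < g.val
      · -- end cut: prefix count 5m, label c + g + 10m
        have hpre : wtPrefix u g.val = 5 * m := by
          rw [hu, wtPrefix_twoBlocks_right (by omega) (by omega), ← hu, hwt]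
        have hc5 : ((5 * m : ℕ) : ZMod 5) = 0 := by
          rw [Nat.cast_mul]
          have : ((5 : ℕ) : ZMod 5) = 0 := by decide
          rw [this, zero_mul]
        rw [hpre, hc5, ← natCast_zmod3_ne_zero_iff]
        have hlab : ((c + g.val + (5 * m + 5 * m) : ℕ) : ZMod 3) = s g + k * t g := by
          rw [hs, ht]
          simp only [hg1, if_false]
          push_cast
          rw [hkm, h5]
          have h22 : (2 + 2 : ZMod 3) = 1 := by decide
          linear_combination k * h22
        rw [hlab]
        simp only [hg2, or_true, true_and]
      · -- middle cut: off
        have hoff := middle_off T c y hT hperf hn g.val (by omega) (by omega) ((wtPrefix u g.val : ℕ) : ZMod 5)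
        have hgeq : (⟨g.val, by omega⟩ : Fin (n + 1)) = g := Fin.ext rfl
        rw [hgeq] at hoff
        rw [hoff]
        simp [hg1, hg2]
  -- perfection at `u_k` gives the odd count
  have h := hperf u
  unfold ringWinU at h
  rw [decide_eq_true_eq, hA] at h
  exact Nat.odd_iff.mpr h

end Coset21

end Summit.QuantumAdvantage.AdviceFreeQNC0
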